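import Summits.ResolutionOfSingularities.KangarooAtlas.MizutaniTowerIdeals
import Summits.ResolutionOfSingularities.KangarooAtlas.MizutaniOperatorBasis
import Summits.ResolutionOfSingularities.KangarooAtlas.MizutaniOdaDuality
import HarnessLib

/-!
# Root towers: the coefficients of `Ω` are the pairings `Σ a_i · D^{(T)} c_i`; `J^m` detected by coefficients; two levels

Cell `pub-rosobs`, Mizutani enclosure (seat mizutani-encloser-1, gen 9).  AI-written; *AI review is weaker than
expert review*; NOT a resolution-of-singularities theorem (summit relevance C).

Infrastructure for Mizutani's Lemma 2.4 in a root tower `k = k^{p^e}(b)` (`IsRootTower`, `MizutaniRootTower`): the coordinate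
map `Ω : k ⊗_L k → k[X]` (`MizutaniRootTowerBridge`) has `T`-th coefficient `coeff_T Ω(y ⊗ z) = y · D^{(T)} z` (the Hasse–Schmidt
operator acting on the RIGHT factor), so for the tensors `tens e a c = Σ a_i ⊗ c_i` of `MizutaniOdaDuality`
**`coeff_Omega_tens : coeff_T Ω(Σ a_i ⊗ c_i) = Σ_i a_i · D^{(T)}(c_i)`**; the converse of `degree_le_of_mem_pow`:
**`mem_pow_of_forall_coeff_Omega`** — if all monomials of `Ω ω` have degree `≥ m` then `ω ∈ J^m` (`Ω̃` is a ring isomorphism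
onto `k[u]/(u^q)` carrying `1 ⊗ a_i − a_i ⊗ 1` to `u_i`, and a polynomial with all monomials of degree `≥ m` lies in `(X_i)^m`); and for TWO tower structures
on the same field with the same generators (`k` over `k^{p^{e+1}}` of order `p^{e+1}` and over `k^{p^e}` of order `p^e`):
**`hsD_eq_of_towers`** — the Hasse–Schmidt operators `D^{(T)}`, `T` in the small box, COINCIDE (both are `b^N ↦ C(N,T) b^{N−T}`).

References: [EGAIV4] Thm. 16.11.2; [Oda1983HironakaGroupSchemeII] §1 (p. 1166); [Mizutani1973HironakaGroupSchemes] Lemma 2.4.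
-/

noncomputable section

open MvPolynomial TensorProduct Literature.AlgebraicGeometry.Resolution
  Literature.AlgebraicGeometry.Resolution.HironakaScheme

namespace Summit.ResolutionOfSingularities.KangarooAtlas.Mizutani

universe u

/-! ## Coefficients of `Ω` -/

section Coeff

variable {L K : Type u} [Field L] [Field K] [Algebra L K] {s p e : ℕ} [hp : Fact p.Prime] [CharP K p]
  {x : Fin s → L} {a : Fin s → K}

/-- **`coeff_T Ω(y ⊗ z) = y · D^{(T)} z`**: the Taylor coefficients of the right factor. [cite: EGAIV4, Thm. 16.11.2 (D_p = the coefficients of the Taylor morphism)] -/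
theorem IsRootTower.coeff_Omega_tmul (h : IsRootTower L K (p ^ e) x a) (y z : K) (T : Fin s →₀ ℕ) :
    coeff T (h.Omega (y ⊗ₜ[L] z)) = y * h.hsD T z := by
  rw [h.Omega_tmul, coeff_C_mul, h.hsD_apply]

/-- On a sum of pure tensors: `coeff_T Ω(Σ_i y_i ⊗ z_i) = Σ_i y_i · D^{(T)} z_i`. [folklore] -/
theorem IsRootTower.coeff_Omega_sum_tmul (h : IsRootTower L K (p ^ e) x a) {ι : Type*} (t : Finset ι) (y z : ι → K)
    (T : Fin s →₀ ℕ) : coeff T (h.Omega (∑ i ∈ t, y i ⊗ₜ[L] z i)) = ∑ i ∈ t, y i * h.hsD T (z i) := by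
  rw [map_sum, coeff_sum]
  exact Finset.sum_congr rfl fun i _ => h.coeff_Omega_tmul (y i) (z i) T

/-! ## `J^m` is detected by the coefficients of `Ω` -/

omit [CharP K p] in
/-- A polynomial all of whose monomials have degree `≥ m` lies in `(X_i : i)^m`. [folklore] -/
theorem mem_span_X_pow_of_degree_le {m : ℕ} {f : MvPolynomial (Fin s) K} (hf : ∀ M ∈ f.support, m ≤ M.degree) :
    f ∈ Ideal.span (Set.range fun i : Fin s => (X i : MvPolynomial (Fin s) K)) ^ m := by
  classical
  set I := Ideal.span (Set.range fun i : Fin s => (X i : MvPolynomial (Fin s) K)) with hI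
  rw [f.as_sum]
  refine Submodule.sum_mem _ fun M hM => ?_
  have hsplit : monomial M (coeff M f) = C (coeff M f) * ∏ i, (X i : MvPolynomial (Fin s) K) ^ M i := by
    rw [monomial_eq, Finsupp.prod_fintype _ _ (fun i => by simp)]
  rw [hsplit]
  refine Ideal.mul_mem_left _ _ ?_
  have hmem : (∏ i, (X i : MvPolynomial (Fin s) K) ^ M i) ∈ I ^ (∑ i, M i) :=
    prod_pow_mem_pow I Finset.univ _ _ fun i _ => Ideal.subset_span ⟨i, rfl⟩
  have hdeg : m ≤ ∑ i, M i := by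
    have := hf M hM
    rwa [Finsupp.degree_eq_sum] at this
  exact Ideal.pow_le_pow_right hdeg hmem

/-- `[u_i] ∈ Ω̃(J)`: `Ω̃(1 ⊗ a_i − a_i ⊗ 1) = (a_i + u_i) − a_i`. [cite: Oda1983HironakaGroupSchemeII, §1 (p. 1166: δa = 1 ⊗ a − a ⊗ 1)] -/
theorem IsRootTower.mk_X_mem_map (h : IsRootTower L K (p ^ e) x a) (i : Fin s) :
    Ideal.Quotient.mk (boxIdeal (Fin s) K (p ^ e)) (X i) ∈ (KaehlerDifferential.ideal L K).map h.omegaTilde := by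
  have hgen : (1 : K) ⊗ₜ[L] a i - a i ⊗ₜ[L] (1 : K) ∈ KaehlerDifferential.ideal L K :=
    KaehlerDifferential.one_smul_sub_smul_one_mem_ideal L (a i)
  have himg := Ideal.mem_map_of_mem h.omegaTilde hgen
  rw [map_sub, (h.omegaTilde_one_tmul (a i)).1, (h.omegaTilde_one_tmul (a i)).2, h.tau_gen, ← map_sub,
    add_sub_cancel_left] at himg
  exact himg

/-- **The converse of `degree_le_of_mem_pow`**: if every monomial of `Ω ω` has degree `≥ m`, then `ω ∈ J^m`
(`Ω̃` is a bijective ring homomorphism carrying `1 ⊗ a_i − a_i ⊗ 1` to `u_i`). [cite: Oda1983HironakaGroupSchemeII, §1 (p. 1166: {(δa)^λ : |λ| ≥ r} is a basis of Δ^{(r)})] -/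
theorem IsRootTower.mem_pow_of_forall_coeff_Omega (h : IsRootTower L K (p ^ e) x a) {m : ℕ} {ω : K ⊗[L] K}
    (hω : ∀ M ∈ (h.Omega ω).support, m ≤ M.degree) : ω ∈ KaehlerDifferential.ideal L K ^ m := by
  have hbij := h.omegaTilde_bijective h.finrank_eq
  -- the box representative of `Ω̃ ω` lies in `(X_i : i)^m`, whose image under `mk` lies in `Ω̃(J)^m`
  have hf := mem_span_X_pow_of_degree_le (K := K) hω
  have himg := Ideal.mem_map_of_mem (Ideal.Quotient.mk (boxIdeal (Fin s) K (p ^ e))) hf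
  rw [h.Omega_eq, mk_truncQ, Ideal.map_pow, Ideal.map_span] at himg
  have hle : Ideal.span ((Ideal.Quotient.mk (boxIdeal (Fin s) K (p ^ e))) ''
      Set.range fun i : Fin s => (X i : MvPolynomial (Fin s) K)) ≤ (KaehlerDifferential.ideal L K).map h.omegaTilde := by
    rw [Ideal.span_le]
    rintro _ ⟨_, ⟨i, rfl⟩, rfl⟩
    exact h.mk_X_mem_map i
  have h2 : h.omegaTilde ω ∈ (KaehlerDifferential.ideal L K ^ m).map h.omegaTilde := by
    rw [Ideal.map_pow]
    exact Ideal.pow_right_mono hle m himg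
  have h3 : ω ∈ ((KaehlerDifferential.ideal L K ^ m).map h.omegaTilde).comap h.omegaTilde := h2
  rwa [Ideal.comap_map_of_bijective _ hbij] at h3

/-- **`ω ∈ J^m ⟺` every monomial of `Ω ω` has degree `≥ m`**, for every `m`. [cite: Oda1983HironakaGroupSchemeII, §1 (p. 1166)] -/
theorem IsRootTower.mem_pow_iff_forall_coeff_Omega (h : IsRootTower L K (p ^ e) x a) (m : ℕ) (ω : K ⊗[L] K) :
    ω ∈ KaehlerDifferential.ideal L K ^ m ↔ ∀ M ∈ (h.Omega ω).support, m ≤ M.degree := by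
  refine ⟨fun hω => ?_, h.mem_pow_of_forall_coeff_Omega⟩
  rw [h.Omega_eq]
  exact mem_degIdeal_iff.mp (h.omegaTilde_mem_degIdeal hω)

end Coeff

/-! ## Two tower structures on one field: the Hasse–Schmidt operators of the small box coincide -/

section TwoLevels

variable (k : Type u) [Field k] (p : ℕ) [hp : Fact p.Prime] [CharP k p] {n s : ℕ} (e : ℕ)
  {b : Fin s → k} {x₁ : Fin s → frobPow k p (e + 1)} {x₀ : Fin s → frobPow k p e}

/-- **Coefficients of `Ω` on `tens`**: `coeff_T Ω(Σ a_i ⊗ c_i) = Σ_i a_i · D^{(T)}(c_i)` for a root tower structure of `k` over `k^{p^e}`.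
[cite: EGAIV4, Thm. 16.11.2] -/
theorem coeff_Omega_tens {x : Fin s → frobPow k p e} (h : IsRootTower (frobPow k p e) k (p ^ e) x b)
    (a c : Fin (n + 1) → k) (T : Fin s →₀ ℕ) : coeff T (h.Omega (tens k p e a c)) = ∑ i, a i * h.hsD T (c i) := by
  unfold tens
  exact h.coeff_Omega_sum_tmul Finset.univ a c T

/-- **The Hasse–Schmidt operators of the two levels coincide on the small box**: if `k` is a root tower over `k^{p^{e+1}}` (order
`p^{e+1}`) and over `k^{p^e}` (order `p^e`) with the SAME generators `b`, then `D₁^{(T)} = D₀^{(T)}` for `T` in the box of side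
`p^e` (both map `b^N ↦ C(N,T) b^{N−T}` for every `N`). [cite: EGAIV4, Thm. 16.11.2 (16.11.2.1)] -/
theorem hsD_eq_of_towers (h₁ : IsRootTower (frobPow k p (e + 1)) k (p ^ (e + 1)) x₁ b)
    (h₀ : IsRootTower (frobPow k p e) k (p ^ e) x₀ b) {T : Fin s →₀ ℕ} (hT : InBox (p ^ e) T) (y : k) :
    h₁.hsD T y = h₀.hsD T y := by
  have hT₁ : InBox (p ^ (e + 1)) T := fun i =>
    lt_of_lt_of_le (hT i) (Nat.pow_le_pow_right hp.out.pos (Nat.le_succ e))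
  -- `h₀.hsD T` as a `k^{p^{e+1}}`-linear map
  let Ψ : k →ₗ[frobPow k p (e + 1)] k :=
    { toFun := h₀.hsD T
      map_add' := fun y z => map_add _ y z
      map_smul' := fun c z => by
        have hc : (c : k) ∈ frobPow k p e := frobPow_anti (Nat.le_succ e) c.2
        have := (h₀.hsD T).map_smul (⟨(c : k), hc⟩ : frobPow k p e) z
        rw [Subfield.smul_def, Subfield.smul_def] at this
        rw [RingHom.id_apply, Subfield.smul_def, Subfield.smul_def]
        exact this }
  have hΨ : ∀ z, Ψ z = h₀.hsD T z := fun _ => rfl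
  rw [← hΨ]
  refine congrArg (fun Φ : k →ₗ[frobPow k p (e + 1)] k => Φ y) (h₁.linearMap_ext_boxMonomials (Ψ := Ψ) fun N _ => ?_)
  rw [hΨ, h₁.hsD_prod_pow hT₁ N, h₀.hsD_prod_pow hT N]

end TwoLevels

end Summit.ResolutionOfSingularities.KangarooAtlas.Mizutani

end
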